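import Literature.Analysis.FluidPDE.DivFreeVectorPotential
import Literature.Analysis.FluidPDE.BallCutoff
import Literature.Analysis.FluidPDE.KatoSymmetryCovariance
import HarnessLib

/-!
# The divergence-free localisation of the datum (Jia–Šverák 2014, proofs of Thm. 3.1 / Thm. 3.2)

Analysis/FluidPDE theorem file (no new definitions, no named facts) in the proof programme of the
named fact `Literature.Analysis.FluidPDE.jia_sverak_2014_theorem_3_2`
(`JiaSverak2014LocalRegularity.lean`; H. Jia, V. Šverák, Invent. Math. 196 (2014) =
arXiv:1204.0529, §3 Thm. 3.2). Both Thm. 3.1 and Thm. 3.2 start from a decomposition of the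
datum (arXiv p. 7, statement of Thm. 3.1, and p. 9, proof of Thm. 3.2):

> "Let us decompose `u₀ = u₀¹ + u₀²` with `div u₀¹ = 0`, `u₀¹|_{B_{4/3}} = u₀`,
> `supp u₀¹ ⋐ B₂(0)` and `‖u₀¹‖ ≤ C M`" — footnote: "Such decomposition is well-known. One can
> for example first localize `u₀` using a smooth cutoff function, and then use Bogovskii's lemma
> to deal with the divergence-free condition."

This file PROVES the decomposition, at an arbitrary centre `x₀`, for measurable weakly
divergence-free data `u₀ ∈ L²_loc` bounded by `M` on `B₂(x₀)`, with an absolute constant `C`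
(`exists_divFree_localization`). Instead of Bogovskiĭ's operator (not in Mathlib) the corrector
is the tree's explicit divergence-free cut-off by the Poincaré cone potential
(`isWeaklyDivFree_cutoff_conePotential`, `DivFreeVectorPotential.lean`):
`u₀¹(x) = ζ(x - x₀) u₀(x) + ∇ζ(x - x₀) × K[u₀(· + x₀)](x - x₀)` with `ζ` the smooth cutoff equal
to `1` on `B̄_{4/3}` and `0` off `B₂` (`ballCutoff 0 (2/3)`) and `K f (y) = ∫₀¹ t f(ty) × y dt`;
since `K` at `y` only sees `f` on the segment `[0, y]`, the bound `|u₀| ≤ M` on the ball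
`B₂(x₀)` (star-shaped about `x₀`) gives `|K| ≤ 2M` where `∇ζ ≠ 0`, whence `|u₀¹| ≤ C M`
everywhere. Also recorded: the `L^p` memberships of `u₀¹` consumed by the mild-solution theory
(`L³`, `L²`, `L^∞`).

## Mathlib / tree search

Tree: `isWeaklyDivFree_cutoff_conePotential`, `conePotential`, `enorm_conePotential_le`,
`enorm_coneIntegrand_le`, `aestronglyMeasurable_conePotential` (`PoincareHomotopyOperator*`,
`DivFreeVectorPotential`); `ballCutoff` with `exists_norm_fderiv_ballCutoff_le` (`BallCutoff`);
`IsWeaklyDivFree.comp_sub_right` (`KatoSymmetryCovariance`). Mathlib: `IsLocalMin.fderiv_eq_zero`,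
`measurePreserving_add_right`, `MeasurableEquiv.addRight`, `memLp_top_of_bound`,
`MemLp.mono_exponent_of_measure_support_ne_top`. No Bogovskiĭ operator in Mathlib or the tree
(`lean search 'Bogovski'`: docstring mentions only).

## References

* H. Jia, V. Šverák, Invent. Math. 196 (2014) 233–265 = arXiv:1204.0529, §3: statement of
  Thm. 3.1 with its footnote (arXiv p. 7), proof of Thm. 3.2 (arXiv p. 9). [`JiaSverak2014`]
* A. Fonda, *The Kurzweil–Henstock Integral for Undergraduates* (2018), Thm. 3.31 (the cone
  potential). [`Fonda2018`]
-/

noncomputable section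

open MeasureTheory TopologicalSpace Set Function Filter Metric
open _root_.Topology
open scoped ENNReal NNReal RealInnerProductSpace

namespace Literature.Analysis.FluidPDE

/-! ### Local square integrability from ball bounds, and translation of ball integrals -/

/-- Translating the variable translates the ball: `∫_{B(z,ρ)} G(x + a) dx = ∫_{B(z+a,ρ)} G`. [folklore] -/
theorem setLIntegral_ball_comp_add_right (G : (EuclideanSpace ℝ (Fin 3)) → ℝ≥0∞) (z a : (EuclideanSpace ℝ (Fin 3))) (ρ : ℝ) :
    ∫⁻ x in ball z ρ, G (x + a) = ∫⁻ y in ball (z + a) ρ, G y := by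
  have hmp : MeasurePreserving (fun x : (EuclideanSpace ℝ (Fin 3)) => x + a) volume volume := measurePreserving_add_right _ a
  have hemb : MeasurableEmbedding (fun x : (EuclideanSpace ℝ (Fin 3)) => x + a) := (MeasurableEquiv.addRight a).measurableEmbedding
  have hpre : (fun x : (EuclideanSpace ℝ (Fin 3)) => x + a) ⁻¹' (ball (z + a) ρ) = ball z ρ := by
    ext x
    simp only [mem_preimage, mem_ball, dist_add_right]
  rw [← hmp.setLIntegral_comp_preimage_emb hemb G (ball (z + a) ρ), hpre]

/-- A measurable field with finite `L²`-mass on every unit ball has locally integrable `|·|²`. [folklore] -/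
theorem locallyIntegrable_norm_sq_of_forall_unitBall {f : (EuclideanSpace ℝ (Fin 3)) → (EuclideanSpace ℝ (Fin 3))} (hf : AEStronglyMeasurable f volume)
    (h : ∀ z : (EuclideanSpace ℝ (Fin 3)), ∫⁻ x in ball z 1, ‖f x‖ₑ ^ 2 < ∞) :
    LocallyIntegrable (fun x => ‖f x‖ ^ 2) volume := by
  intro z
  refine ⟨ball z 1, ball_mem_nhds z one_pos, ?_⟩
  refine ⟨(hf.norm.pow 2).restrict, ?_⟩
  rw [hasFiniteIntegral_iff_enorm]
  refine lt_of_eq_of_lt (lintegral_congr fun x => ?_) (h z)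
  rw [Real.enorm_eq_ofReal (sq_nonneg _), ENNReal.ofReal_pow (norm_nonneg _), ofReal_norm]

/-! ### Pointwise bound for the cone potential on a star of bounded data -/

/-- **The cone potential of a field bounded by `M` on `B₂(0)` is bounded by `2M` on `B₂(0)`**:
`K f (y) = ∫₀¹ t f(ty) × y dt` only sees `f` on the segment `[0, y] ⊆ B₂(0)` for `|y| < 2`, and
`|t f(ty) × y| ≤ |y| |f(ty)| ≤ 2M`. [folklore] -/
theorem norm_conePotential_le_of_bound {f : (EuclideanSpace ℝ (Fin 3)) → (EuclideanSpace ℝ (Fin 3))} {M : ℝ} (hM : 0 ≤ M)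
    (hf : ∀ y ∈ ball (0 : (EuclideanSpace ℝ (Fin 3))) 2, ‖f y‖ ≤ M) {y : (EuclideanSpace ℝ (Fin 3))} (hy : y ∈ ball (0 : (EuclideanSpace ℝ (Fin 3))) 2) :
    ‖conePotential f y‖ ≤ 2 * M := by
  have hy2 : ‖y‖ < 2 := by simpa using hy
  have hpt : ∀ t ∈ Ioc (0 : ℝ) 1, ‖coneIntegrand f t y‖ₑ ≤ ENNReal.ofReal (2 * M) := by
    intro t ht
    have hty : t • y ∈ ball (0 : (EuclideanSpace ℝ (Fin 3))) 2 := by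
      rw [mem_ball_zero_iff, norm_smul, Real.norm_eq_abs, abs_of_pos ht.1]
      calc t * ‖y‖ ≤ 1 * ‖y‖ := mul_le_mul_of_nonneg_right ht.2 (norm_nonneg _)
        _ < 2 := by rw [one_mul]; exact hy2
    calc ‖coneIntegrand f t y‖ₑ ≤ ENNReal.ofReal t * (‖y‖ₑ * ‖f (t • y)‖ₑ) :=
          enorm_coneIntegrand_le f ht.1.le y
      _ ≤ ENNReal.ofReal 1 * (ENNReal.ofReal 2 * ENNReal.ofReal M) := by
          gcongr
          · exact ht.2
          · rw [← ofReal_norm]; exact ENNReal.ofReal_le_ofReal hy2.le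
          · rw [← ofReal_norm]; exact ENNReal.ofReal_le_ofReal (hf _ hty)
      _ = ENNReal.ofReal (2 * M) := by
          rw [ENNReal.ofReal_one, one_mul, ← ENNReal.ofReal_mul (by norm_num : (0 : ℝ) ≤ 2)]
  have hK : ‖conePotential f y‖ₑ ≤ ENNReal.ofReal (2 * M) := by
    calc ‖conePotential f y‖ₑ ≤ ∫⁻ t in Ioc (0 : ℝ) 1, ‖coneIntegrand f t y‖ₑ := enorm_conePotential_le f y
      _ ≤ ∫⁻ _ in Ioc (0 : ℝ) 1, ENNReal.ofReal (2 * M) := setLIntegral_mono measurable_const hpt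
      _ = ENNReal.ofReal (2 * M) := by
          rw [setLIntegral_const, Real.volume_Ioc, sub_zero, ENNReal.ofReal_one, mul_one]
  rw [← ofReal_norm] at hK
  exact (ENNReal.ofReal_le_ofReal_iff (by positivity)).1 hK

/-! ### The cutoff `ζ` : `1` on `B̄_{4/3}`, `0` off `B₂` -/

/-- The gradient of the cutoff `ζ = ballCutoff 0 (2/3)` vanishes on the open ball `B_{4/3}(0)`
(where `ζ ≡ 1`). [folklore] -/
theorem fderiv_ballCutoff_twoThirds_eq_zero_of_mem {y : (EuclideanSpace ℝ (Fin 3))} (hy : y ∈ ball (0 : (EuclideanSpace ℝ (Fin 3))) (4 / 3)) :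
    fderiv ℝ (ballCutoff (0 : (EuclideanSpace ℝ (Fin 3))) (2 / 3)) y = 0 := by
  have h : ballCutoff (0 : (EuclideanSpace ℝ (Fin 3))) (2 / 3) =ᶠ[𝓝 y] fun _ => (1 : ℝ) :=
    ballCutoff_eventuallyEq_one (by norm_num) (by norm_num; simpa using hy)
  rw [h.fderiv_eq, fderiv_const_apply]

/-- The gradient of the cutoff `ζ = ballCutoff 0 (2/3)` vanishes off the open ball `B₂(0)`
(there `ζ = 0` is a minimum of the nonnegative `ζ`). [folklore] -/
theorem fderiv_ballCutoff_twoThirds_eq_zero_of_not_mem {y : (EuclideanSpace ℝ (Fin 3))} (hy : y ∉ ball (0 : (EuclideanSpace ℝ (Fin 3))) 2) :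
    fderiv ℝ (ballCutoff (0 : (EuclideanSpace ℝ (Fin 3))) (2 / 3)) y = 0 := by
  have hy2 : 3 * (2 / 3 : ℝ) ≤ ‖y - 0‖ := by
    rw [sub_zero]; norm_num; simpa using hy
  have h0 : ballCutoff (0 : (EuclideanSpace ℝ (Fin 3))) (2 / 3) y = 0 := ballCutoff_eq_zero (by norm_num) hy2
  have hmin : IsLocalMin (ballCutoff (0 : (EuclideanSpace ℝ (Fin 3))) (2 / 3)) y :=
    Filter.Eventually.of_forall fun z => by rw [h0]; exact ballCutoff_nonneg _ _ _
  exact hmin.fderiv_eq_zero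

/-! ### The decomposition -/

/-- **The divergence-free localisation of the datum** (Jia–Šverák 2014, statement of Thm. 3.1
and proof of Thm. 3.2: "decompose `u₀ = u₀¹ + u₀²` with `div u₀¹ = 0`, `u₀¹|_{B_{4/3}} = u₀`,
`supp u₀¹ ⋐ B₂` and `‖u₀¹‖ ≤ C M`", at an arbitrary centre `x₀` and with Bogovskiĭ's corrector
replaced by the cone-potential cut-off of the tree). There is an absolute constant `C ≥ 0` such
that: for every a.e.-strongly measurable, weakly divergence-free `u₀ : (EuclideanSpace ℝ (Fin 3)) → (EuclideanSpace ℝ (Fin 3))` with finite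
`L²`-mass on unit balls, every centre `x₀` and every `M` with `|u₀| ≤ M` on `B₂(x₀)`, there is a
field `u₀¹` which is a.e.-strongly measurable, weakly divergence free, equal to `u₀` on
`B_{4/3}(x₀)`, vanishing off `B₂(x₀)`, and bounded by `C M` everywhere.
[cite: JiaSverak2014, §3 Thm. 3.1 (statement, footnote on the decomposition) and proof of Thm. 3.2 (arXiv:1204.0529 pp. 7, 9)] -/
theorem exists_divFree_localization :
    ∃ C : ℝ, 0 ≤ C ∧ ∀ (u₀ : (EuclideanSpace ℝ (Fin 3)) → (EuclideanSpace ℝ (Fin 3))) (x₀ : (EuclideanSpace ℝ (Fin 3))) (M : ℝ),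
      AEStronglyMeasurable u₀ volume → IsWeaklyDivFree u₀ →
      (∀ z : (EuclideanSpace ℝ (Fin 3)), ∫⁻ x in ball z 1, ‖u₀ x‖ₑ ^ 2 < ∞) →
      (∀ x ∈ ball x₀ 2, ‖u₀ x‖ ≤ M) →
      ∃ b : (EuclideanSpace ℝ (Fin 3)) → (EuclideanSpace ℝ (Fin 3)), AEStronglyMeasurable b volume ∧ IsWeaklyDivFree b ∧
        (∀ x ∈ ball x₀ (4 / 3), b x = u₀ x) ∧ (∀ x, x ∉ ball x₀ 2 → b x = 0) ∧
        ∀ x, ‖b x‖ ≤ C * M := by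
  obtain ⟨C₀, hC₀, hgrad⟩ := exists_norm_fderiv_ballCutoff_le
  refine ⟨1 + 3 * C₀, by positivity, fun u₀ x₀ M hm hdiv hloc hM => ?_⟩
  -- the cutoff
  set ζ : (EuclideanSpace ℝ (Fin 3)) → ℝ := ballCutoff (0 : (EuclideanSpace ℝ (Fin 3))) (2 / 3) with hζ
  have hζs : ContDiff ℝ 2 ζ := contDiff_ballCutoff _ _
  have hζc : HasCompactSupport ζ := hasCompactSupport_ballCutoff (by norm_num)
  have hζg : ∀ y, ‖gradient ζ y‖ ≤ 3 * C₀ / 2 := fun y => by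
    rw [gradient, LinearIsometryEquiv.norm_map]
    have := hgrad 0 (2 / 3) (by norm_num) y
    rw [hζ]; convert this using 1; ring
  -- the translated datum
  set f : (EuclideanSpace ℝ (Fin 3)) → (EuclideanSpace ℝ (Fin 3)) := fun y => u₀ (y + x₀) with hf
  have hfm : AEStronglyMeasurable f volume := hm.comp_measurePreserving (measurePreserving_add_right _ x₀)
  have hfloc : ∀ z : (EuclideanSpace ℝ (Fin 3)), ∫⁻ x in ball z 1, ‖f x‖ₑ ^ 2 < ∞ := fun z => by
    have := setLIntegral_ball_comp_add_right (fun y => ‖u₀ y‖ₑ ^ 2) z x₀ 1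
    rw [hf]; simp only at this ⊢; rw [this]; exact hloc _
  have hf2 : LocallyIntegrable (fun x => ‖f x‖ ^ 2) volume :=
    locallyIntegrable_norm_sq_of_forall_unitBall hfm hfloc
  have hfdiv : IsWeaklyDivFree f := by
    have h := hdiv.comp_sub_right (-x₀)
    simpa only [sub_neg_eq_add] using h
  have hfM : ∀ y ∈ ball (0 : (EuclideanSpace ℝ (Fin 3))) 2, ‖f y‖ ≤ M := fun y hy => hM _ (by
    rw [mem_ball, dist_eq_norm, add_sub_cancel_right]; simpa using hy)
  have hM0 : 0 ≤ M := (norm_nonneg _).trans (hM x₀ (mem_ball_self (by norm_num)))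
  -- the cut-off field at the origin and its translate
  set g : (EuclideanSpace ℝ (Fin 3)) → (EuclideanSpace ℝ (Fin 3)) := fun y => ζ y • f y + cross (gradient ζ y) (conePotential f y) with hg
  have hgdiv : IsWeaklyDivFree g := isWeaklyDivFree_cutoff_conePotential hfm hf2 hfdiv hζs hζc
  have hgm : AEStronglyMeasurable g volume := by
    refine ((contDiff_ballCutoff (0 : (EuclideanSpace ℝ (Fin 3))) (2 / 3) (n := 0)).continuous.aestronglyMeasurable.smul hfm).add ?_
    exact crossCLM.continuous₂.comp_aestronglyMeasurable₂
      (continuous_gradient_of_contDiff (hζs.of_le one_le_two)).aestronglyMeasurable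
      (aestronglyMeasurable_conePotential hfm)
  refine ⟨fun x => g (x - x₀), hgm.comp_measurePreserving (measurePreserving_sub_right _ x₀),
    hgdiv.comp_sub_right x₀, fun x hx => ?_, fun x hx => ?_, fun x => ?_⟩
  · -- agreement on `B_{4/3}(x₀)`
    have hy : x - x₀ ∈ ball (0 : (EuclideanSpace ℝ (Fin 3))) (4 / 3) := by
      rw [mem_ball_zero_iff, ← dist_eq_norm]; exact hx
    have h1 : ζ (x - x₀) = 1 := ballCutoff_eq_one (by norm_num) (by
      rw [sub_zero]; norm_num; exact le_of_lt (by simpa using hy))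
    have h2 : gradient ζ (x - x₀) = 0 := by
      rw [gradient, fderiv_ballCutoff_twoThirds_eq_zero_of_mem hy, map_zero]
    show ζ (x - x₀) • f (x - x₀) + cross (gradient ζ (x - x₀)) (conePotential f (x - x₀)) = u₀ x
    rw [h1, one_smul, h2, ← crossCLM_apply, map_zero, _root_.zero_apply, add_zero, hf]
    simp only [sub_add_cancel]
  · -- vanishing off `B₂(x₀)`
    have hy : x - x₀ ∉ ball (0 : (EuclideanSpace ℝ (Fin 3))) 2 := by
      rw [mem_ball_zero_iff, ← dist_eq_norm]; exact hx
    have h1 : ζ (x - x₀) = 0 := ballCutoff_eq_zero (by norm_num) (by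
      rw [sub_zero]; norm_num; simpa using hy)
    have h2 : gradient ζ (x - x₀) = 0 := by
      rw [gradient, fderiv_ballCutoff_twoThirds_eq_zero_of_not_mem hy, map_zero]
    show ζ (x - x₀) • f (x - x₀) + cross (gradient ζ (x - x₀)) (conePotential f (x - x₀)) = 0
    rw [h1, zero_smul, h2, ← crossCLM_apply, map_zero, _root_.zero_apply, add_zero]
  · -- the bound `‖u₀¹‖ ≤ (1 + 3C₀) M`
    by_cases hy : x - x₀ ∈ ball (0 : (EuclideanSpace ℝ (Fin 3))) 2
    · have hx : x ∈ ball x₀ 2 := by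
        rw [mem_ball, dist_eq_norm]; simpa using hy
      show ‖ζ (x - x₀) • f (x - x₀) + cross (gradient ζ (x - x₀)) (conePotential f (x - x₀))‖ ≤ _
      have hfx : f (x - x₀) = u₀ x := by rw [hf]; simp only [sub_add_cancel]
      calc ‖ζ (x - x₀) • f (x - x₀) + cross (gradient ζ (x - x₀)) (conePotential f (x - x₀))‖
          ≤ ‖ζ (x - x₀) • f (x - x₀)‖ + ‖cross (gradient ζ (x - x₀)) (conePotential f (x - x₀))‖ :=
            norm_add_le _ _
        _ ≤ 1 * M + (3 * C₀ / 2) * (2 * M) := by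
            refine add_le_add ?_ ?_
            · rw [norm_smul, hfx]
              exact mul_le_mul (by simpa using abs_ballCutoff_le_one (0 : (EuclideanSpace ℝ (Fin 3))) (2 / 3) (x - x₀))
                (hM x hx) (norm_nonneg _) zero_le_one
            · exact (norm_cross_le _ _).trans (mul_le_mul (hζg _)
                (norm_conePotential_le_of_bound hM0 hfM hy) (norm_nonneg _) (by positivity))
        _ = (1 + 3 * C₀) * M := by ring
    · have hx : x ∉ ball x₀ 2 := by
        rw [mem_ball, dist_eq_norm]; simpa using hy
      have h1 : ζ (x - x₀) = 0 := ballCutoff_eq_zero (by norm_num) (by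
        rw [sub_zero]; norm_num; simpa using hy)
      have h2 : gradient ζ (x - x₀) = 0 := by
        rw [gradient, fderiv_ballCutoff_twoThirds_eq_zero_of_not_mem hy, map_zero]
      show ‖ζ (x - x₀) • f (x - x₀) + cross (gradient ζ (x - x₀)) (conePotential f (x - x₀))‖ ≤ _
      rw [h1, zero_smul, h2, ← crossCLM_apply, map_zero, _root_.zero_apply, add_zero, norm_zero]
      positivity

/-! ### `L^p` bookkeeping for the localised datum -/

/-- A bounded measurable field vanishing off a ball is in every `L^p`, `p ∈ [0, ∞]`, with
`‖·‖_{L^∞} ≤ K`. [folklore] -/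
theorem memLp_of_bound_of_eq_zero_off_ball {b : (EuclideanSpace ℝ (Fin 3)) → (EuclideanSpace ℝ (Fin 3))} (hb : AEStronglyMeasurable b volume)
    {K : ℝ} (hK : ∀ x, ‖b x‖ ≤ K) {x₀ : (EuclideanSpace ℝ (Fin 3))} {R : ℝ} (h0 : ∀ x, x ∉ ball x₀ R → b x = 0)
    (p : ℝ≥0∞) : MemLp b p volume ∧ eLpNorm b ∞ volume ≤ ENNReal.ofReal K := by
  have htop : MemLp b ∞ volume := memLp_top_of_bound hb K (Eventually.of_forall hK)
  refine ⟨htop.mono_exponent_of_measure_support_ne_top h0 measure_ball_lt_top.ne le_top, ?_⟩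
  exact eLpNorm_le_of_ae_bound (Eventually.of_forall hK) |>.trans (by simp)

end Literature.Analysis.FluidPDE

end
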